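import Literature.NumberTheory.Automorphic.SmoothIndCellFunTorusTransport
import Literature.NumberTheory.Automorphic.JacquetModule
import HarnessLib

/-!
# The character of the Levi on the open-cell line of a Jacquet module, via the Haar functional

Topic `NumberTheory/Automorphic`; namespace `Literature.NumberTheory.Automorphic`.  THEOREMS ONLY: no definition, no named fact, no `sorry`,
no instance declaration, no notation.  Registry pub/hodgecm-mathlib F0∕P3, T3b statement tree, node N1 ([Casselman1995, Lemma 7.1.1 (a)]) —
brick (T-ℓ) «the torus acts on the open-cell line of `r_B i_G(χ)` by `wχ`», file T3a (generic part; the `U(3)` instance is the Summits-side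
`Theorems/F0P3U3PrincipalSeriesOpenCellTorusChar`).

## The mathematics ([BernsteinZelevinsky1977, §5 (5.2), Geometrical Lemma 2.12]; [Casselman1995, §6.3, Lemma 7.1.1 (a)])

Frame of ★ `SmoothIndOpenCellHaarFunctional` ∕ ★ `SmoothIndCellFunTorusTransport`: `H ≤ G`, `σ` on a Banach space `W`, `Ind_H^G σ`
(★ `Representation.SmoothInd`), `ι : Γ →* G`, `w₀ ∈ G`, the Haar functional `Λ(f) = ∫_Γ f(w₀ ι γ) dμ(γ)` for a right-invariant `μ`.
* §1 **`Λ` DESCENDS TO COINVARIANT CLASSES**: if `f, f'` have compactly supported cell functions and the same class in the `Γ`-coinvariants of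
  `Ind_H^G σ ∘ ι` (resp. in the Jacquet-module carrier `(t.restrict _).Coinvariants` of a parabolic triple), then `Λ(f) = Λ(f')`
  (contrapositive of ★ `SmoothInd.mk_coinvariants_ne_zero_of_integral_cellFun_ne_zero`, §1 of (L-a): left exactness of coinvariants).
* §2 **THE LINE CHARACTER** (`t = (P, M, N)` a parabolic triple, `Γ = N`, `ρ = Ind_P^G τ`): let `ℓ ≤ r(ρ)` be the submodule of classes of
  sections vanishing at `1` («the open-cell part», `hℓ`), assumed finite-dimensional of dimension `≤ 1` (the upper bound of the geometric lemma,
  ★ `SmoothIndOpenCellCoinvariants`), every such section having compactly supported cell function (`hcs`, ★ `SmoothIndCellFunCompactSupport`),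
  and let `Φ` be one such section with `Λ(Φ) ≠ 0` (the standard section, ★ `CMPrincipalSeriesOpenCellSection`).  For `m ∈ M` with
  `w₀ m w₀⁻¹ ∈ P`, `n m = m c(n)` on `N`, `μ.map c = κ • μ` and `τ(w₀ m w₀⁻¹) = s` on `W` (★ T1 `integral_cellFun_smoothIndRep_of_conj`:
  `Λ(m · f) = s κ Λ(f)`), the NORMALISED Jacquet action of `m` on `ℓ` is the scalar `θ = δ_P^{-1∕2}(m) · s · κ`:
  **`∀ x ∈ ℓ, r(m) x = θ • x`** (`normalizedJacquet_eq_smul_of_openCellLine`).  Proof: `ℓ = ℂ [Φ]`; `r(m)[Φ] ∈ ℓ` is `b [Φ]`; applying `Λ`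
  (§1) to `δ^{-1∕2}(m) • m·Φ` and `b • Φ` gives `δ^{-1∕2} s κ Λ(Φ) = b Λ(Φ)`, so `b = θ`.
For `U(Φ₃)(L⁺_v)` (`κ = δ_B(m)` by T2 ★ `CMBorelTorusConjHaar`, `s = (χ δ_B^{1∕2})(ʷm)` with `χ(ʷm) = wχ(m)` by T3b ★ `CMBorelWeylTorusConjugate`)
`θ = wχ(m)` — [Casselman1995, L. 7.1.1 (a)]: «`0 → (w⁻¹σ)δ^{1∕2} → I_N → σδ^{1∕2} → 0`».
HC_CM is proved only modulo the printed citations until rung 0 closes; this file discharges no named fact.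

## References
* [BernsteinZelevinsky1977] I. N. Bernstein, A. V. Zelevinsky, Ann. Sci. ÉNS 10 (1977), Prop. 1.9 (a), §2.3, Geometrical Lemma 2.12, §5 (5.2).
* [Casselman1995] W. Casselman, *Introduction to the theory of admissible representations of `p`-adic reductive groups* (1995), §3.2, §6.3,
  Lemma 7.1.1 (a).
-/

set_option autoImplicit false

noncomputable section

open MeasureTheory
open scoped NNReal ENNReal

namespace Literature.NumberTheory.Automorphic

/-! ## §1 `Λ` descends to coinvariant classes -/

section Descends

variable {G : Type*} [Group G] [TopologicalSpace G] [IsTopologicalGroup G] (H : Subgroup G)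
  {W : Type*} [NormedAddCommGroup W] [NormedSpace ℂ W] (σ : Representation ℂ H W)
  {Γ : Type*} [Group Γ] [TopologicalSpace Γ] [IsTopologicalGroup Γ] [MeasurableSpace Γ] [BorelSpace Γ]
  (ι : Γ →* G) (w₀ : G) (μ : Measure Γ) [IsFiniteMeasureOnCompacts μ]

/-- **`Λ` descends to the `Γ`-coinvariants**: two sections with compactly supported cell functions and the same class in the
`Γ`-coinvariants of `Ind_H^G σ ∘ ι` have the same Haar functional `∫ f (w₀ ι γ) dμ` (`μ` right invariant, finite on compacts; `Γ` a limit
of compact open subgroups).  Contrapositive of ★ `SmoothInd.mk_coinvariants_ne_zero_of_integral_cellFun_ne_zero` applied to `f − f'`.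
[cite: BernsteinZelevinsky1977, Prop. 1.9 (a) and §5 (5.2)] [cite: Casselman1995, §6.3] -/
theorem SmoothInd.integral_cellFun_eq_of_mk_eq [μ.IsMulRightInvariant] (hΓ : IsLimitOfCompactOpen Γ) (hι : Continuous ι)
    (f f' : Representation.SmoothInd H σ) (hf : HasCompactSupport fun γ => f.toFun (w₀ * ι γ))
    (hf' : HasCompactSupport fun γ => f'.toFun (w₀ * ι γ))
    (h : Representation.Coinvariants.mk ((Representation.smoothIndRep H σ).comp ι) f =
      Representation.Coinvariants.mk ((Representation.smoothIndRep H σ).comp ι) f') :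
    ∫ γ, f.toFun (w₀ * ι γ) ∂μ = ∫ γ, f'.toFun (w₀ * ι γ) ∂μ := by
  by_contra hne
  have hsub : HasCompactSupport fun γ => (f - f').toFun (w₀ * ι γ) := by
    simp only [sub_eq_add_neg, Representation.SmoothInd.toFun_add, Pi.add_apply]
    refine hf.add ?_
    have : (fun γ => (-f').toFun (w₀ * ι γ)) = fun γ => -(f'.toFun (w₀ * ι γ)) := by
      funext γ
      rw [show (-f' : Representation.SmoothInd H σ) = (-1 : ℂ) • f' from (neg_one_smul ℂ f').symm,
        Representation.SmoothInd.toFun_smul, Pi.smul_apply, neg_one_smul]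
    rw [this]
    exact hf'.neg
  have hint : ∫ γ, (f - f').toFun (w₀ * ι γ) ∂μ ≠ 0 := by
    have hsplit : (fun γ => (f - f').toFun (w₀ * ι γ)) = fun γ => f.toFun (w₀ * ι γ) - f'.toFun (w₀ * ι γ) := by
      funext γ
      rw [show (f - f' : Representation.SmoothInd H σ) = f + (-1 : ℂ) • f' by rw [neg_one_smul, sub_eq_add_neg],
        Representation.SmoothInd.toFun_add, Representation.SmoothInd.toFun_smul, Pi.add_apply, Pi.smul_apply, neg_one_smul,
        sub_eq_add_neg]
    rw [hsplit, integral_sub (SmoothInd.integrable_cellFun H σ ι w₀ μ hι hf) (SmoothInd.integrable_cellFun H σ ι w₀ μ hι hf')]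
    exact sub_ne_zero.2 hne
  have hmk : Representation.Coinvariants.mk ((Representation.smoothIndRep H σ).comp ι) (f - f') = 0 := by
    rw [map_sub, h, sub_self]
  exact SmoothInd.mk_coinvariants_ne_zero_of_integral_cellFun_ne_zero H σ ι w₀ μ hΓ hι (f - f') hsub hint hmk

end Descends

/-! ## §2 The line character on a parabolic triple `t = (P, M, N)` -/

section Vanish

variable {G : Type*} [Group G] [TopologicalSpace G] [IsTopologicalGroup G] (t : ParabolicTriple G)
  {W : Type*} [AddCommGroup W] [Module ℂ W] (τ : Representation ℂ ↥t.P W)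

/-- the translate `m · f` of a section vanishing at `1` by `m ∈ P` vanishes at `1` (`(m·f)(1) = f(m) = τ(m) f(1)`). [cite: BernsteinZelevinsky1977, §2.3] -/
theorem SmoothInd.toFun_one_smoothIndRep_eq_zero {p : G} (hp : p ∈ t.P) (f : Representation.SmoothInd t.P τ) (hf : f.toFun 1 = 0) :
    (Representation.smoothIndRep t.P τ p f).toFun 1 = 0 := by
  rw [Representation.toFun_smoothIndRep_apply, one_mul]
  have h := f.toFun_subgroup_mul ⟨p, hp⟩ 1
  rw [mul_one, Subgroup.coe_mk] at h
  rw [h, hf, map_zero]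

end Vanish

section Parabolic

variable {G : Type*} [Group G] [TopologicalSpace G] [IsTopologicalGroup G] (t : ParabolicTriple G) [LocallyCompactSpace ↥t.P]
  {W : Type*} [NormedAddCommGroup W] [NormedSpace ℂ W] (τ : Representation ℂ ↥t.P W)
  [MeasurableSpace ↥t.N] [BorelSpace ↥t.N] [SecondCountableTopologyEither ↥t.N W]
  (μ : Measure ↥t.N) [IsFiniteMeasureOnCompacts μ] (w₀ : G)

omit [LocallyCompactSpace ↥t.P] [SecondCountableTopologyEither ↥t.N W] in
/-- **`Λ` descends to the Jacquet-module carrier** `(t.restrict (Ind_P^G τ)).Coinvariants` (★ `ParabolicTriple.mk_restrict_eq_zero_iff` reduces to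
§1 with `ι = N.subtype`). [cite: BernsteinZelevinsky1977, Prop. 1.9 (a) and §5 (5.2)] -/
theorem ParabolicTriple.integral_cellFun_eq_of_mk_restrict_eq [μ.IsMulRightInvariant] (hN : IsLimitOfCompactOpen ↥t.N)
    (f f' : Representation.SmoothInd t.P τ) (hf : HasCompactSupport fun n : ↥t.N => f.toFun (w₀ * n))
    (hf' : HasCompactSupport fun n : ↥t.N => f'.toFun (w₀ * n))
    (h : Representation.Coinvariants.mk (t.restrict (Representation.smoothIndRep t.P τ)) f =
      Representation.Coinvariants.mk (t.restrict (Representation.smoothIndRep t.P τ)) f') :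
    ∫ n, f.toFun (w₀ * n) ∂μ = ∫ n, f'.toFun (w₀ * n) ∂μ := by
  refine SmoothInd.integral_cellFun_eq_of_mk_eq t.P τ t.N.subtype w₀ μ hN continuous_subtype_val f f' hf hf' ?_
  have h0 : Representation.Coinvariants.mk (t.restrict (Representation.smoothIndRep t.P τ)) (f - f') = 0 := by
    rw [map_sub, h, sub_self]
  rw [ParabolicTriple.mk_restrict_eq_zero_iff] at h0
  rwa [map_sub, sub_eq_zero] at h0

/-- **THE LINE CHARACTER OF THE OPEN CELL** ([Casselman1995, Lemma 7.1.1 (a)]; [BernsteinZelevinsky1977, Geometrical Lemma 2.12]): in the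
Jacquet module `r(Ind_P^G τ)` (★ `normalizedJacquet` on `(t.restrict _).Coinvariants`), let `ℓ` be the submodule of the classes of sections
vanishing at `1` (`hℓ`), finite-dimensional of dimension `≤ 1` (`hfin`, `h1`), every such section having compactly supported cell function at
`w₀` (`hcs`), and `Φ` one of them with `∫_N Φ(w₀ n) dμ ≠ 0`.  For `m ∈ M` with `w₀ m w₀⁻¹ ∈ P`, `n m = m c(n)` (`c` measurable,
`μ.map c = κ • μ`) and `τ(w₀ m w₀⁻¹) = s` on `W`, writing `θ = δ_P^{-1∕2}(m) s κ`: **`r(m) x = θ • x` for every `x ∈ ℓ`**.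
[cite: Casselman1995, Lemma 7.1.1 (a) and §6.3] [cite: BernsteinZelevinsky1977, §5 (5.2)] -/
theorem ParabolicTriple.normalizedJacquet_eq_smul_of_openCellLine [μ.IsMulRightInvariant] (hN : IsLimitOfCompactOpen ↥t.N)
    (hcs : ∀ f : Representation.SmoothInd t.P τ, f.toFun 1 = 0 → HasCompactSupport fun n : ↥t.N => f.toFun (w₀ * n))
    (m : ↥t.M) (hm : w₀ * (m : G) * w₀⁻¹ ∈ t.P) (c : ↥t.N → ↥t.N) (hcm : Measurable c)
    (hc : ∀ n : ↥t.N, (n : G) * (m : G) = (m : G) * (c n : G)) {κ : ℝ≥0} (hμ : μ.map c = κ • μ)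
    {s : ℂ} (hs : ∀ w : W, τ ⟨w₀ * (m : G) * w₀⁻¹, hm⟩ w = s • w)
    {θ : ℂ} (hθ : (((rootDeltaChar t.P (Subgroup.inclusion t.M_le m))⁻¹ : ℂˣ) : ℂ) * (s * (κ : ℂ)) = θ)
    (ℓ : Submodule ℂ (t.restrict (Representation.smoothIndRep t.P τ)).Coinvariants)
    (hℓ : ∀ x, x ∈ ℓ ↔ ∃ f : Representation.SmoothInd t.P τ,
      f.toFun 1 = 0 ∧ Representation.Coinvariants.mk (t.restrict (Representation.smoothIndRep t.P τ)) f = x)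
    (hfin : FiniteDimensional ℂ ↥ℓ) (h1 : Module.finrank ℂ ↥ℓ ≤ 1)
    (Φ : Representation.SmoothInd t.P τ) (hΦ1 : Φ.toFun 1 = 0) (hΦ : ∫ n, Φ.toFun (w₀ * n) ∂μ ≠ 0) :
    ∀ x ∈ ℓ, (Representation.smoothIndRep t.P τ).normalizedJacquet t m x = θ • x := by
  haveI := hfin
  -- the class of `Φ` spans `ℓ`
  have hΦℓ : Representation.Coinvariants.mk (t.restrict (Representation.smoothIndRep t.P τ)) Φ ∈ ℓ := (hℓ _).2 ⟨Φ, hΦ1, rfl⟩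
  have hΦne : (⟨Representation.Coinvariants.mk (t.restrict (Representation.smoothIndRep t.P τ)) Φ, hΦℓ⟩ : ↥ℓ) ≠ 0 := by
    intro h0
    have h0' : Representation.Coinvariants.mk (t.restrict (Representation.smoothIndRep t.P τ)) Φ = Representation.Coinvariants.mk (t.restrict (Representation.smoothIndRep t.P τ)) 0 := by
      rw [map_zero]; exact congrArg Subtype.val h0
    have hz : HasCompactSupport fun n : ↥t.N => (0 : Representation.SmoothInd t.P τ).toFun (w₀ * n) :=
      hcs 0 rfl
    have := ParabolicTriple.integral_cellFun_eq_of_mk_restrict_eq t τ μ w₀ hN Φ 0 (hcs Φ hΦ1) hz h0'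
    apply hΦ
    rw [this]
    exact integral_zero _ _
  have hrank : Module.finrank ℂ ↥ℓ = 1 :=
    le_antisymm h1 (Module.finrank_pos_iff_exists_ne_zero.2 ⟨_, hΦne⟩)
  have hspan := (finrank_eq_one_iff_of_nonzero' _ hΦne).1 hrank
  -- `r(m)[Φ] ∈ ℓ`, hence `r(m)[Φ] = b [Φ]`
  have hmΦ1 : (Representation.smoothIndRep t.P τ (m : G) Φ).toFun 1 = 0 := SmoothInd.toFun_one_smoothIndRep_eq_zero t τ (t.M_le m.2) Φ hΦ1
  have hmem : (Representation.smoothIndRep t.P τ).normalizedJacquet t m (Representation.Coinvariants.mk (t.restrict (Representation.smoothIndRep t.P τ)) Φ) ∈ ℓ := by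
    rw [Representation.normalizedJacquet_mk]
    exact ℓ.smul_mem _ ((hℓ _).2 ⟨Representation.smoothIndRep t.P τ (m : G) Φ, hmΦ1, rfl⟩)
  obtain ⟨b, hb⟩ := hspan ⟨_, hmem⟩
  have hb' : (Representation.smoothIndRep t.P τ).normalizedJacquet t m (Representation.Coinvariants.mk (t.restrict (Representation.smoothIndRep t.P τ)) Φ) =
      b • Representation.Coinvariants.mk (t.restrict (Representation.smoothIndRep t.P τ)) Φ := by
    have := congrArg Subtype.val hb
    simpa only [Submodule.coe_smul] using this.symm
  -- identify `b = θ` by applying `Λ`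
  set δ : ℂ := (((rootDeltaChar t.P (Subgroup.inclusion t.M_le m))⁻¹ : ℂˣ) : ℂ) with hδ
  have hcls : Representation.Coinvariants.mk (t.restrict (Representation.smoothIndRep t.P τ)) (δ • Representation.smoothIndRep t.P τ (m : G) Φ) =
      Representation.Coinvariants.mk (t.restrict (Representation.smoothIndRep t.P τ)) (b • Φ) := by
    rw [map_smul, map_smul, ← hb', Representation.normalizedJacquet_mk]
  have hcs1 : HasCompactSupport fun n : ↥t.N => (δ • Representation.smoothIndRep t.P τ (m : G) Φ).toFun (w₀ * n) := by
    refine hcs _ ?_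
    rw [Representation.SmoothInd.toFun_smul, Pi.smul_apply, hmΦ1, smul_zero]
  have hcs2 : HasCompactSupport fun n : ↥t.N => (b • Φ).toFun (w₀ * n) := by
    refine hcs _ ?_
    rw [Representation.SmoothInd.toFun_smul, Pi.smul_apply, hΦ1, smul_zero]
  have hΛ := ParabolicTriple.integral_cellFun_eq_of_mk_restrict_eq t τ μ w₀ hN _ _ hcs1 hcs2 hcls
  simp only [Representation.SmoothInd.toFun_smul, Pi.smul_apply, integral_smul] at hΛ
  have hT1 : ∫ n : ↥t.N, (Representation.smoothIndRep t.P τ (m : G) Φ).toFun (w₀ * n) ∂μ = (s * (κ : ℂ)) • ∫ n : ↥t.N, Φ.toFun (w₀ * n) ∂μ :=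
    SmoothInd.integral_cellFun_smoothIndRep_of_conj t.P τ t.N.subtype w₀ μ continuous_subtype_val (m : G) hm c hcm hc hμ hs Φ
  rw [hT1, smul_smul, hθ] at hΛ
  have hbθ : b = θ := by
    have h2 : (θ - b) • ∫ n : ↥t.N, Φ.toFun (w₀ * n) ∂μ = 0 := by rw [sub_smul, hΛ, sub_self]
    rcases smul_eq_zero.1 h2 with h3 | h3
    · exact (sub_eq_zero.1 h3).symm
    · exact absurd h3 hΦ
  -- conclude on `ℓ = ℂ [Φ]`
  intro x hx
  obtain ⟨a, ha⟩ := hspan ⟨x, hx⟩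
  have hax : x = a • Representation.Coinvariants.mk (t.restrict (Representation.smoothIndRep t.P τ)) Φ := by
    have := congrArg Subtype.val ha
    simpa only [Submodule.coe_smul] using this.symm
  rw [hax, map_smul, hb', hbθ, smul_comm]

end Parabolic

end Literature.NumberTheory.Automorphic

end
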